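import Summits.RiemannHypothesis.RiemannHypothesis.Theses.LiDirichletEcho
import Summits.RiemannHypothesis.RiemannHypothesis.Theorems.LiPrimeEchoWindowAdjust
import Literature.NumberTheory.LFunctions.CharZeroSum
import Literature.Analysis.SpecialFunctions.DigammaLogBound
import HarnessLib

/-!
# RiemannHypothesis / LiDirichletEcho — support `CharWindowAdjust`: moving the window ends of `L(s, χ)` costs `O(log n)`
# (RH-FREE, GRH-FREE)

RH-FREE · GRH-FREE [rh-li-eng g5, acting as prover on the unstaffed route].  Route `Theses/LiDirichletEcho.lean` (rung
«Li PRIME-ECHO LAW FOR DIRICHLET CHARACTERS» `LiTheory.LiZeroWindowEchoDirichlet`, L-P(P1χ); cell `pub/rh-li`, dossier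
`theory/route/p5`), support item `CharWindowAdjust` (stmt-RiemannHypothesis-19403; the first skeleton statement behind the
route Assembly): for primitive `χ` mod `q > 1` and `c ≥ 1` there are `N`, `C = C(q)` such that for `n ≥ N`,
`√n ≤ T₁ ≤ √n + 1`, `c√n ≤ T₂ ≤ c√n + 1`,

  `|charUpperTraceWindow χ n √n (c√n) − charUpperTraceWindow χ n T₁ T₂| ≤ C log n` and
  `|charSmoothTraceWindow χ n √n (c√n) − charSmoothTraceWindow χ n T₁ T₂| ≤ C log n`.

Proof (the ζ template `Theorems/LiPrimeEchoWindowAdjust.lean` of the CLOSED route LiPrimeEcho).  UPPER TRACE: a unit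
step `(a, a']`, `a' ≤ a + 1`, of the upper trace is `Re Σ_{a < Im ρ ≤ a'} m(ρ)(1 − 1/ρ)ⁿ`; for `Im ρ ≥ √n`, WHATEVER the
real part of the zero, `|(1 − 1/ρ)ⁿ| ≤ e^{1/2}` (`WindowAdjust.norm_pow_one_sub_inv_le`), and the zeros of `L(s, χ)` in a
unit window have total multiplicity `≤ C(log q + log(|τ| + 4))` (`ExplicitPsiChar.exists_sum_window_le`, MV Thm 10.17).
SMOOTH MEAN: `g_χ(t) = ½ Re ψ((½ + a + it)/2) + ½ log(q/π)` is continuous with `|g_χ(t)| ≤ ½ log(t + 4) + 4 + ½|log(q/π)|`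
for `t ≥ 1` (`norm_digamma_le_log_height`), and the two end pieces have length `≤ 1`.  Nothing about the position of the
zeros is used; nothing here bears on the truth of RH or GRH.
-/

noncomputable section

-- D-0017: `Summit.<S>.<S>.…` is the designed namespace of a single-problem summit.
set_option linter.dupNamespace false

open Complex MeasureTheory intervalIntegral Set
open scoped Real ComplexConjugate Interval

namespace Summit.RiemannHypothesis.RiemannHypothesis.Theorems.LiTheory

open Literature.NumberTheory.LFunctions Literature.NumberTheory.LFunctions.ExplicitPsiChar

namespace WindowAdjustChar

variable {q : ℕ} [NeZero q] {χ : DirichletCharacter ℂ q}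

/-! ### The upper trace: a unit step -/

/-- A step of the upper trace is the Li sum over the zeros of the step: for `0 ≤ a ≤ a'` (`χ ≠ 1`),
`U(a') − U(a) = Re Σᶠ_{a < Im ρ ≤ a'} m(ρ)(1 − 1/ρ)ⁿ`. -/
theorem charUpperZeroTrace_sub_eq (h1 : χ ≠ 1) (n : ℕ) {a a' : ℝ} (ha : 0 ≤ a) (haa' : a ≤ a') :
    charUpperZeroTrace χ n a' - charUpperZeroTrace χ n a =
      (∑ᶠ ρ ∈ {ρ : ℂ | ρ ∈ charNontrivialZeros χ ∧ a < ρ.im ∧ ρ.im ≤ a'},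
        (DirichletDisc.zeroOrder χ ρ : ℂ) * (1 - 1 / ρ) ^ n).re := by
  set S₁ : Set ℂ := lfunctionZeroBox χ a ∩ {ρ : ℂ | 0 < ρ.im} with hS₁
  set W : Set ℂ := {ρ : ℂ | ρ ∈ charNontrivialZeros χ ∧ a < ρ.im ∧ ρ.im ≤ a'} with hW
  have hS₁f : S₁.Finite := (lfunctionZeroBox_finite h1 a).subset inter_subset_left
  have hWf : W.Finite := by
    refine (lfunctionZeroBox_finite h1 a').subset ?_
    rintro ρ ⟨hρ, h3, h4⟩
    obtain ⟨hL, h0, h1'⟩ := mem_charNontrivialZeros.1 hρ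
    exact mem_lfunctionZeroBox.2 ⟨hL, h0, h1', abs_le.2 ⟨by linarith, h4⟩⟩
  have hunion : lfunctionZeroBox χ a' ∩ {ρ : ℂ | 0 < ρ.im} = S₁ ∪ W := by
    ext ρ
    simp only [hS₁, hW, mem_inter_iff, mem_union, mem_setOf_eq, mem_lfunctionZeroBox, mem_charNontrivialZeros]
    constructor
    · rintro ⟨⟨hL, h0, h1', habs⟩, him⟩
      by_cases hle : ρ.im ≤ a
      · exact Or.inl ⟨⟨hL, h0, h1', abs_le.2 ⟨by linarith, hle⟩⟩, him⟩
      · exact Or.inr ⟨⟨hL, h0, h1'⟩, lt_of_not_ge hle, (abs_le.1 habs).2⟩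
    · rintro (⟨⟨hL, h0, h1', habs⟩, him⟩ | ⟨⟨hL, h0, h1'⟩, h3, h4⟩)
      · exact ⟨⟨hL, h0, h1', (abs_le.2 ⟨by linarith [(abs_le.1 habs).1], by linarith [(abs_le.1 habs).2]⟩)⟩, him⟩
      · exact ⟨⟨hL, h0, h1', abs_le.2 ⟨by linarith, h4⟩⟩, by
          show 0 < ρ.im
          linarith⟩
  have hdisj : Disjoint S₁ W := by
    rw [Set.disjoint_left]
    rintro ρ ⟨hρ, -⟩ ⟨-, h3, -⟩
    have := (abs_le.1 (mem_lfunctionZeroBox.1 hρ).2.2.2).2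
    linarith
  unfold charUpperZeroTrace
  rw [hunion, finsum_mem_union hdisj hS₁f hWf, Complex.add_re]
  ring

/-- **Upper-trace step bound (RH-FREE, GRH-FREE):** there is `C = C₀` (absolute) such that for primitive `χ` mod `q > 1`,
`1 ≤ n ≤ a²`, `0 ≤ a ≤ a' ≤ a + 1`: `|U(a') − U(a)| ≤ e^{1/2} C (log q + log(|a + 1/2| + 4))`. -/
theorem abs_charUpperZeroTrace_step_le :
    ∃ C : ℝ, 0 < C ∧ ∀ (q : ℕ) [NeZero q] (χ : DirichletCharacter ℂ q), χ.IsPrimitive → 1 < q →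
      ∀ (n : ℕ) (a a' : ℝ), 1 ≤ n → (n : ℝ) ≤ a ^ 2 → 0 ≤ a → a ≤ a' → a' ≤ a + 1 →
        |charUpperZeroTrace χ n a' - charUpperZeroTrace χ n a| ≤
          Real.exp (1 / 2) * (C * (Real.log q + Real.log (|a + 1 / 2| + 4))) := by
  classical
  obtain ⟨C, hC0, hC⟩ := exists_sum_window_le
  refine ⟨C, hC0, fun q _ χ hχ hq n a a' hn hna ha haa' ha1 ↦ ?_⟩
  have h1 : χ ≠ 1 := ne_one_of_isPrimitive hχ hq
  rw [charUpperZeroTrace_sub_eq h1 n ha haa']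
  set W : Set ℂ := {ρ : ℂ | ρ ∈ charNontrivialZeros χ ∧ a < ρ.im ∧ ρ.im ≤ a'} with hW
  have hWf : W.Finite := by
    refine (lfunctionZeroBox_finite h1 a').subset ?_
    rintro ρ ⟨hρ, h3, h4⟩
    obtain ⟨hL, h0, h1'⟩ := mem_charNontrivialZeros.1 hρ
    exact mem_lfunctionZeroBox.2 ⟨hL, h0, h1', abs_le.2 ⟨by linarith, h4⟩⟩
  set P := hWf.toFinset with hP
  have hmem : ∀ ρ, ρ ∈ P ↔ ρ ∈ W := fun ρ ↦ Set.Finite.mem_toFinset _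
  rw [finsum_mem_eq_finite_toFinset_sum _ hWf, Complex.re_sum]
  -- the window condition for `exists_sum_window_le` with `τ = a + 1/2`
  have hPcond : ∀ ρ ∈ P, χ.LFunction ρ = 0 ∧ 0 < ρ.re ∧ ρ.re < 1 ∧ |ρ.im - (a + 1 / 2)| ≤ 1 / 2 := by
    intro ρ hρ
    obtain ⟨hρ', h3, h4⟩ := (hmem ρ).1 hρ
    obtain ⟨hL, h0, h1'⟩ := mem_charNontrivialZeros.1 hρ'
    exact ⟨hL, h0, h1', abs_le.2 ⟨by linarith, by linarith⟩⟩
  have hcount := hC q χ hχ hq (a + 1 / 2) P hPcond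
  -- termwise: `|Re(m zⁿ)| ≤ m e^{1/2}`
  have hterm : ∀ ρ ∈ P, |((DirichletDisc.zeroOrder χ ρ : ℂ) * (1 - 1 / ρ) ^ n).re| ≤
      (DirichletDisc.zeroOrder χ ρ : ℝ) * Real.exp (1 / 2) := by
    intro ρ hρ
    obtain ⟨hρ', h3, -⟩ := (hmem ρ).1 hρ
    obtain ⟨-, h0, -⟩ := mem_charNontrivialZeros.1 hρ'
    have hγ : (n : ℝ) ≤ ρ.im ^ 2 := hna.trans (by nlinarith)
    have hm : (0 : ℝ) ≤ DirichletDisc.zeroOrder χ ρ := Nat.cast_nonneg _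
    have hre : ((DirichletDisc.zeroOrder χ ρ : ℂ) * (1 - 1 / ρ) ^ n).re =
        (DirichletDisc.zeroOrder χ ρ : ℝ) * ((1 - 1 / ρ) ^ n).re := by
      simp [Complex.mul_re]
    rw [hre, abs_mul, abs_of_nonneg hm]
    exact mul_le_mul_of_nonneg_left
      ((Complex.abs_re_le_norm _).trans (WindowAdjust.norm_pow_one_sub_inv_le n h0.le hn hγ)) hm
  calc |∑ ρ ∈ P, ((DirichletDisc.zeroOrder χ ρ : ℂ) * (1 - 1 / ρ) ^ n).re|
      ≤ ∑ ρ ∈ P, |((DirichletDisc.zeroOrder χ ρ : ℂ) * (1 - 1 / ρ) ^ n).re| := Finset.abs_sum_le_sum_abs _ _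
    _ ≤ ∑ ρ ∈ P, (DirichletDisc.zeroOrder χ ρ : ℝ) * Real.exp (1 / 2) := Finset.sum_le_sum hterm
    _ = Real.exp (1 / 2) * ∑ ρ ∈ P, (DirichletDisc.zeroOrder χ ρ : ℝ) := by rw [Finset.mul_sum]; simp [mul_comm]
    _ ≤ Real.exp (1 / 2) * (C * (Real.log q + Real.log (|a + 1 / 2| + 4))) :=
        mul_le_mul_of_nonneg_left hcount (Real.exp_pos _).le

/-! ### The smooth density of the character -/

omit [NeZero q] in
/-- `g_χ` as a digamma value: `charGammaDensity χ t = Re ψ((½ + a + it)/2)/2 + log(q/π)/2`. -/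
theorem charGammaDensity_eq (χ : DirichletCharacter ℂ q) (t : ℝ) :
    charGammaDensity χ t =
      (Complex.digamma ((1 / 2 + (charParity χ : ℂ) + (t : ℂ) * I) / 2)).re / 2 + Real.log (q / Real.pi) / 2 := by
  rw [charGammaDensity, Complex.digamma_def]

omit [NeZero q] in
/-- `|g_χ(t)| ≤ ½ log(t + 4) + 4 + ½|log(q/π)|` for `t ≥ 1`. -/
theorem abs_charGammaDensity_le (χ : DirichletCharacter ℂ q) {t : ℝ} (ht : 1 ≤ t) :
    |charGammaDensity χ t| ≤ Real.log (t + 4) / 2 + 4 + |Real.log (q / Real.pi)| / 2 := by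
  have ha0 : (0 : ℝ) ≤ charParity χ := Nat.cast_nonneg _
  have ha1 : (charParity χ : ℝ) ≤ 1 := by exact_mod_cast charParity_le_one χ
  set v : ℂ := (1 / 2 + (charParity χ : ℂ) + (t : ℂ) * I) / 2 with hv
  have hvre' : v.re = (1 / 2 + (charParity χ : ℝ)) / 2 := by
    rw [hv]; simp
  have hvim' : v.im = t / 2 := by
    rw [hv]; simp
  have hvre : 0 < v.re := by rw [hvre']; positivity
  have hvim : 1 / 2 ≤ |v.im| := by
    rw [hvim', abs_of_pos (by positivity)]
    linarith
  have hvn : ‖v‖ ≤ t + 3 := by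
    rw [hv, norm_div, Complex.norm_two]
    have : ‖(1 / 2 + (charParity χ : ℂ) + (t : ℂ) * I)‖ ≤ 1 / 2 + charParity χ + t := by
      calc ‖(1 / 2 + (charParity χ : ℂ) + (t : ℂ) * I)‖
          ≤ ‖(1 / 2 : ℂ) + (charParity χ : ℂ)‖ + ‖(t : ℂ) * I‖ := norm_add_le _ _
        _ ≤ (‖(1 / 2 : ℂ)‖ + ‖(charParity χ : ℂ)‖) + ‖(t : ℂ) * I‖ := by gcongr; exact norm_add_le _ _
        _ = 1 / 2 + charParity χ + t := by
            simp [abs_of_pos (by linarith : (0 : ℝ) < t)]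
    rw [div_le_iff₀ (by norm_num : (0 : ℝ) < 2)]
    linarith
  have hd := norm_digamma_le_log_height hvre hvim hvn
  have hre : |(Complex.digamma v).re| ≤ Real.log (t + 4) + 8 := (Complex.abs_re_le_norm _).trans hd
  rw [charGammaDensity_eq, ← hv]
  calc |(Complex.digamma v).re / 2 + Real.log (q / Real.pi) / 2|
      ≤ |(Complex.digamma v).re / 2| + |Real.log (q / Real.pi) / 2| := abs_add_le _ _
    _ = |(Complex.digamma v).re| / 2 + |Real.log (q / Real.pi)| / 2 := by
        rw [abs_div, abs_div, abs_two]
    _ ≤ (Real.log (t + 4) + 8) / 2 + |Real.log (q / Real.pi)| / 2 := by gcongr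
    _ = Real.log (t + 4) / 2 + 4 + |Real.log (q / Real.pi)| / 2 := by ring

omit [NeZero q] in
/-- `g_χ` is continuous. -/
theorem continuousAt_charGammaDensity (χ : DirichletCharacter ℂ q) (t : ℝ) : ContinuousAt (charGammaDensity χ) t := by
  have ha0 : (0 : ℝ) ≤ charParity χ := Nat.cast_nonneg _
  have hfun : charGammaDensity χ = fun t : ℝ ↦
      (Complex.digamma ((1 / 2 + (charParity χ : ℂ) + (t : ℂ) * I) / 2)).re / 2 + Real.log (q / Real.pi) / 2 :=
    funext (charGammaDensity_eq χ)
  rw [hfun]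
  have hc : Continuous fun t : ℝ ↦ (1 / 2 + (charParity χ : ℂ) + (t : ℂ) * I) / 2 := by fun_prop
  have hψ : ContinuousAt (fun t : ℝ ↦ Complex.digamma ((1 / 2 + (charParity χ : ℂ) + (t : ℂ) * I) / 2)) t := by
    refine (continuousAt_digamma_of_re_pos ?_).comp hc.continuousAt
    have : (((1 : ℂ) / 2 + (charParity χ : ℂ) + (t : ℂ) * I) / 2).re = (1 / 2 + (charParity χ : ℝ)) / 2 := by
      simp
    rw [this]; positivity
  exact ((Complex.continuous_re.continuousAt.comp hψ).div_const 2).add continuousAt_const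

omit [NeZero q] in
/-- The smooth integrand is continuous on every `[a, b]` with `a > 0`. -/
theorem continuousOn_smooth_integrand (χ : DirichletCharacter ℂ q) (n : ℕ) {a b : ℝ} (ha : 0 < a) (hab : a ≤ b) :
    ContinuousOn (fun t ↦ Real.cos (n * liZeroAngle t) * charGammaDensity χ t) (uIcc a b) := by
  rw [uIcc_of_le hab]
  have hθ : ContinuousOn liZeroAngle (Icc a b) := fun t ht ↦
    (hasDerivAt_liZeroAngle (by linarith [ht.1] : t ≠ 0)).continuousAt.continuousWithinAt
  have hcos : ContinuousOn (fun t ↦ Real.cos (n * liZeroAngle t)) (Icc a b) :=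
    Real.continuous_cos.comp_continuousOn (continuousOn_const.mul hθ)
  exact hcos.mul fun t _ ↦ (continuousAt_charGammaDensity χ t).continuousWithinAt

omit [NeZero q] in
/-- A unit end piece of the smooth mean: for `1 ≤ a ≤ a' ≤ a + 1`,
`|∫_a^{a'} cos(nθ) g_χ| ≤ ½ log(a + 5) + 4 + ½|log(q/π)|`. -/
theorem abs_integral_end_le (χ : DirichletCharacter ℂ q) (n : ℕ) {a a' : ℝ} (ha : 1 ≤ a) (haa' : a ≤ a')
    (ha' : a' ≤ a + 1) :
    |∫ t in a..a', Real.cos (n * liZeroAngle t) * charGammaDensity χ t| ≤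
      Real.log (a + 5) / 2 + 4 + |Real.log (q / Real.pi)| / 2 := by
  set K : ℝ := Real.log (a + 5) / 2 + 4 + |Real.log (q / Real.pi)| / 2 with hK
  have hK0 : 0 ≤ K := by
    have := Real.log_nonneg (by linarith : (1 : ℝ) ≤ a + 5); rw [hK]; positivity
  have hpt : ∀ t ∈ Ι a a', ‖Real.cos (n * liZeroAngle t) * charGammaDensity χ t‖ ≤ K := by
    intro t ht
    rw [uIoc_of_le haa'] at ht
    have ht1 : 1 ≤ t := by linarith [ht.1]
    rw [Real.norm_eq_abs, abs_mul]
    have hc := Real.abs_cos_le_one (n * liZeroAngle t)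
    have hg := abs_charGammaDensity_le χ ht1
    have hlog : Real.log (t + 4) ≤ Real.log (a + 5) := Real.log_le_log (by linarith) (by linarith [ht.2])
    calc |Real.cos (n * liZeroAngle t)| * |charGammaDensity χ t|
        ≤ 1 * (Real.log (t + 4) / 2 + 4 + |Real.log (q / Real.pi)| / 2) :=
          mul_le_mul hc hg (abs_nonneg _) zero_le_one
      _ ≤ K := by rw [hK]; linarith
  have h := intervalIntegral.norm_integral_le_of_norm_le_const hpt
  rw [Real.norm_eq_abs, abs_of_nonneg (by linarith : (0 : ℝ) ≤ a' - a)] at h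
  have hlen : a' - a ≤ 1 := by linarith
  calc |∫ t in a..a', Real.cos (n * liZeroAngle t) * charGammaDensity χ t| ≤ K * (a' - a) := h
    _ ≤ K * 1 := mul_le_mul_of_nonneg_left hlen hK0
    _ = K := mul_one _

end WindowAdjustChar

open WindowAdjustChar in
/-- **Support `CharWindowAdjust` of route `LiDirichletEcho`** (stmt-RiemannHypothesis-19403; RH-FREE, GRH-FREE): for
primitive `χ` mod `q > 1` and `c ≥ 1` there are `N`, `C` such that for `n ≥ N`, `√n ≤ T₁ ≤ √n + 1`, `c√n ≤ T₂ ≤ c√n + 1`,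
moving the window `(√n, c√n]` to `(T₁, T₂]` changes the upper zero trace and the smooth mean of `L(s, χ)` by at most
`C log n` each. -/
theorem charWindowAdjust_bound {q : ℕ} [NeZero q] (χ : DirichletCharacter ℂ q) (hχ : χ.IsPrimitive) (hq : 1 < q) :
    ∀ c : ℝ, 1 ≤ c → ∃ N : ℕ, ∃ C : ℝ, ∀ n : ℕ, N ≤ n → ∀ T₁ T₂ : ℝ, Real.sqrt n ≤ T₁ → T₁ ≤ Real.sqrt n + 1 →
      c * Real.sqrt n ≤ T₂ → T₂ ≤ c * Real.sqrt n + 1 →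
      |charUpperTraceWindow χ n (Real.sqrt n) (c * Real.sqrt n) - charUpperTraceWindow χ n T₁ T₂| ≤ C * Real.log n ∧
      |charSmoothTraceWindow χ n (Real.sqrt n) (c * Real.sqrt n) - charSmoothTraceWindow χ n T₁ T₂|
        ≤ C * Real.log n := by
  -- adapted from `liWindowAdjust` (Theorems/LiPrimeEchoWindowAdjust.lean, route LiPrimeEcho)
  intro c hc
  obtain ⟨A, hA0, hA⟩ := abs_charUpperZeroTrace_step_le
  set Lq : ℝ := 1 + Real.log q with hLq
  set Kq : ℝ := |Real.log (q / Real.pi)| / 2 with hKq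
  have hq1 : (1 : ℝ) ≤ q := by exact_mod_cast NeZero.one_le
  have hlogq : 0 ≤ Real.log q := Real.log_nonneg hq1
  have hKq0 : 0 ≤ Kq := by positivity
  refine ⟨⌈(c + 5) ^ 2⌉₊, 2 * Real.exp (1 / 2) * A * Lq + 9 + 2 * Kq, fun n hn T₁ T₂ hT₁l hT₁u hT₂l hT₂u ↦ ?_⟩
  -- sizes
  have hc2 : (c + 5) ^ 2 ≤ (n : ℝ) := (Nat.le_ceil _).trans (by exact_mod_cast hn)
  set s := Real.sqrt n with hs
  have hn0 : (0 : ℝ) ≤ n := by positivity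
  have hss : s ^ 2 = n := by rw [hs, Real.sq_sqrt hn0]
  have hs3 : c + 5 ≤ s := by
    rw [hs, ← Real.sqrt_sq (by linarith : 0 ≤ c + 5)]; exact Real.sqrt_le_sqrt hc2
  have hs1 : 1 ≤ s := by linarith
  have hs0 : 0 < s := by linarith
  have hn36 : (36 : ℝ) ≤ n := by nlinarith
  have hn1 : 1 ≤ n := by exact_mod_cast (show (1 : ℝ) ≤ n by linarith)
  have hcs : s ≤ c * s := le_mul_of_one_le_left hs0.le hc
  have htop : c * s + 5 ≤ n := by
    have : (c + 5) * s ≤ s * s := mul_le_mul_of_nonneg_right hs3 hs0.le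
    nlinarith
  have hlogn1 : 1 ≤ Real.log n := by
    rw [Real.le_log_iff_exp_le (by linarith)]
    have := Real.exp_one_lt_d9; linarith
  have hlogn0 : 0 ≤ Real.log n := by linarith
  have hlog_cs : Real.log (c * s + 5) ≤ Real.log n := Real.log_le_log (by positivity) htop
  have hlog_s : Real.log (s + 5) ≤ Real.log n := Real.log_le_log (by positivity) (by nlinarith)
  -- `log q + log(|τ| + 4) ≤ Lq log n` for `τ = s + 1/2`, `c s + 1/2`
  have hL1 : Real.log q + Real.log (|s + 1 / 2| + 4) ≤ Lq * Real.log n := by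
    rw [abs_of_pos (by positivity)]
    have : Real.log (s + 1 / 2 + 4) ≤ Real.log n := (Real.log_le_log (by positivity) (by linarith)).trans hlog_s
    have hprod := mul_nonneg hlogq (sub_nonneg.2 hlogn1)
    rw [hLq]; linarith [hprod]
  have hL2 : Real.log q + Real.log (|c * s + 1 / 2| + 4) ≤ Lq * Real.log n := by
    rw [abs_of_pos (by positivity)]
    have : Real.log (c * s + 1 / 2 + 4) ≤ Real.log n := (Real.log_le_log (by positivity) (by linarith)).trans hlog_cs
    have hprod := mul_nonneg hlogq (sub_nonneg.2 hlogn1)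
    rw [hLq]; linarith [hprod]
  have he := Real.exp_pos (1 / 2 : ℝ)
  constructor
  · -- UPPER TRACE
    have hZ : charUpperTraceWindow χ n s (c * s) - charUpperTraceWindow χ n T₁ T₂ =
        (charUpperZeroTrace χ n T₁ - charUpperZeroTrace χ n s)
          - (charUpperZeroTrace χ n T₂ - charUpperZeroTrace χ n (c * s)) := by
      unfold charUpperTraceWindow; ring
    rw [hZ]
    have hns : (n : ℝ) ≤ s ^ 2 := hss.ge
    have hncs : (n : ℝ) ≤ (c * s) ^ 2 := by nlinarith
    have h1 := hA q χ hχ hq n s T₁ hn1 hns hs0.le hT₁l hT₁u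
    have h2 := hA q χ hχ hq n (c * s) T₂ hn1 hncs (by positivity) hT₂l hT₂u
    calc |charUpperZeroTrace χ n T₁ - charUpperZeroTrace χ n s
          - (charUpperZeroTrace χ n T₂ - charUpperZeroTrace χ n (c * s))|
        ≤ |charUpperZeroTrace χ n T₁ - charUpperZeroTrace χ n s|
          + |charUpperZeroTrace χ n T₂ - charUpperZeroTrace χ n (c * s)| := abs_sub _ _
      _ ≤ Real.exp (1 / 2) * (A * (Lq * Real.log n)) + Real.exp (1 / 2) * (A * (Lq * Real.log n)) :=
          add_le_add (h1.trans (by gcongr)) (h2.trans (by gcongr))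
      _ = (2 * Real.exp (1 / 2) * A * Lq) * Real.log n := by ring
      _ ≤ (2 * Real.exp (1 / 2) * A * Lq + 9 + 2 * Kq) * Real.log n := by
          have h0 : 0 ≤ (9 + 2 * Kq) * Real.log n := by positivity
          linarith [h0]
  · -- SMOOTH MEAN
    set g : ℝ → ℝ := fun t ↦ Real.cos (n * liZeroAngle t) * charGammaDensity χ t with hg
    have hint : ∀ a b : ℝ, 0 < a → a ≤ b → IntervalIntegrable g volume a b := fun a b ha hab ↦
      (continuousOn_smooth_integrand χ n ha hab).intervalIntegrable
    have i1 : IntervalIntegrable g volume s T₁ := hint s T₁ hs0 hT₁l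
    have i2 : IntervalIntegrable g volume T₁ (c * s) := by
      rcases le_total T₁ (c * s) with h | h
      · exact hint T₁ (c * s) (by linarith) h
      · exact (hint (c * s) T₁ (by positivity) h).symm
    have i3 : IntervalIntegrable g volume (c * s) T₂ := hint (c * s) T₂ (by positivity) hT₂l
    have hsplit : (∫ t in s..(c * s), g t) - ∫ t in T₁..T₂, g t = (∫ t in s..T₁, g t) - ∫ t in (c * s)..T₂, g t := by
      rw [← intervalIntegral.integral_add_adjacent_intervals i1 i2,
        ← intervalIntegral.integral_add_adjacent_intervals i2 i3]
      ring
    have hS : charSmoothTraceWindow χ n s (c * s) - charSmoothTraceWindow χ n T₁ T₂ =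
        2 / Real.pi * ((∫ t in s..T₁, g t) - ∫ t in (c * s)..T₂, g t) := by
      unfold charSmoothTraceWindow; rw [← hsplit, mul_sub]
    rw [hS, abs_mul, abs_of_pos (by positivity : (0 : ℝ) < 2 / Real.pi)]
    have e1 := abs_integral_end_le χ n hs1 hT₁l hT₁u
    have e2 := abs_integral_end_le χ n (le_trans hs1 hcs) hT₂l hT₂u
    rw [← hKq] at e1 e2
    have hl1 : Real.log (s + 5) ≤ Real.log n := hlog_s
    have hl2 : Real.log (c * s + 5) ≤ Real.log n := hlog_cs
    have hπ : 2 / Real.pi ≤ 1 := by rw [div_le_one Real.pi_pos]; linarith [Real.pi_gt_three]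
    have hsum : |(∫ t in s..T₁, g t) - ∫ t in (c * s)..T₂, g t| ≤ (9 + 2 * Kq) * Real.log n := by
      refine (abs_sub _ _).trans ?_
      have := add_le_add e1 e2
      have hK := mul_nonneg hKq0 (sub_nonneg.2 hlogn1)
      linarith [hK, this, hl1, hl2, hlogn1]
    have hA7 : (9 + 2 * Kq) * Real.log n ≤ (2 * Real.exp (1 / 2) * A * Lq + 9 + 2 * Kq) * Real.log n := by
      have hLq0 : 0 ≤ Lq := by rw [hLq]; positivity
      have : 0 ≤ 2 * Real.exp (1 / 2) * A * Lq * Real.log n := by positivity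
      linarith [this]
    calc 2 / Real.pi * |(∫ t in s..T₁, g t) - ∫ t in (c * s)..T₂, g t| ≤ 1 * ((9 + 2 * Kq) * Real.log n) :=
          mul_le_mul hπ hsum (abs_nonneg _) zero_le_one
      _ ≤ (2 * Real.exp (1 / 2) * A * Lq + 9 + 2 * Kq) * Real.log n := by linarith

/-- **Item `CharWindowAdjust` of route `LiDirichletEcho`** (stmt-RiemannHypothesis-19403), closed BY NAME. -/
theorem charWindowAdjust_proof :
    Summit.RiemannHypothesis.RiemannHypothesis.Theses.LiDirichletEcho.CharWindowAdjust :=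
  fun _ _ χ hχ hq ↦ charWindowAdjust_bound χ hχ hq

end Summit.RiemannHypothesis.RiemannHypothesis.Theorems.LiTheory

end
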